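import Literature.AlgebraicGeometry.Resolution.PrimeDivisors
import Literature.AlgebraicGeometry.Resolution.InseparableLocalUniformizationHeightZero
import Mathlib.RingTheory.KrullDimension.Field
import HarnessLib

/-!
# Temkin's inseparable local uniformization in dimension one (Temkin 2013, Thm. 1.3.2 for `tr.deg. ≤ 1`)

Topic: `Literature/AlgebraicGeometry/Resolution`. A PROVED special case of the named fact
`Temkin2013` (`LocalUniformization.lean`; M. Temkin, *Inseparable local uniformization*,
J. Algebra 373 (2013) 65–119 = arXiv:0804.1554v3, Thm. 1.3.2: "Let `K/k` be a finitely generated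
field extension, `K°` be a valuation ring of `K` containing `k` … Then there exist finite purely
inseparable extensions `l/k` and `L/lK` … such that … the unique extension of `K°` to a
valuation ring of `L` is centered on a simple `l`-smooth point"), in its weak vendored form
(`IsLocallyUniformizable` over `k` after a finite purely inseparable extension of `K`), for
function fields of transcendence degree `≤ 1`: here NO extension is needed (`L = K`), in every
characteristic. The two cases are already in the tree and are only assembled: the trivial
valuation ring (`K° = K`, height `0`: the centre on any affine model is the generic point, whose
local ring is the field `K`) and the non-trivial ones, which in transcendence degree `1` are
prime divisors (`E = 1`, `F = 0`, `D = 0` by Abhyankar's inequality `E + F ≤ 1` and `E ≥ 1`;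
`PrimeDivisors.lean`: Zariski–Samuel II, VI §14, Thm. 31 — the valuation ring is the local ring
of the normalisation of an affine model at a height-one prime, a discrete valuation ring).
Classically this is the resolution of curves by normalisation; in the DAG of `Temkin2013` it
records that dimension `1` is discharged, the open named facts (`Temkin2013Abhyankar`,
`Temkin2013DescentDefectStep`, `Temkin2013HeightStepOfDescent`) being needed from dimension `2`
on (`(E, F, D) = (1, 0, 1)` already occurs for surfaces).

## Content (everything PROVED)

* `isLocallyUniformizable_top` — the trivial valuation ring `K° = K` is locally uniformizable
  over `k` (on any affine model).
* `residueTrdeg_add_one_eq_of_trdeg_le_one` — a non-trivial valuation ring `K° ∌ K` with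
  `k ⊆ K°` and `tr.deg._k(K) ≤ 1` has `F + 1 = tr.deg._k(K)` (`= 1`), i.e. is a prime divisor.
* `isLocallyUniformizable_of_trdeg_le_one`, `temkin2013_of_trdeg_le_one` — **Thm. 1.3.2 (weak
  form) for `tr.deg._k(K) ≤ 1`, with `L = K`**: every valuation ring of `K/k` containing `k` is
  locally uniformizable over `k`, and the conclusion of `Temkin2013` holds.

## Sources

* M. Temkin, *Inseparable local uniformization*, J. Algebra 373 (2013) = arXiv:0804.1554v3,
  Thm. 1.3.2 (p. 3), §2.1 (Abhyankar's inequality, p. 10).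
* O. Zariski, P. Samuel, *Commutative Algebra* II, Ch. VI §14, Thm. 31 (via `PrimeDivisors.lean`).
-/

noncomputable section

namespace Literature.AlgebraicGeometry.Resolution

open IsLocalRing Cardinal

universe u

variable {k K : Type u} [Field k] [Field K] [Algebra k K]

/-- **The trivial valuation ring is locally uniformizable**: for `K° = K` the centre on any
affine model `A` is the zero ideal and `A_{(0)} = Frac A = K` is a field, a regular local ring.
PROVED. [folklore] -/
theorem isLocallyUniformizable_top (hfg : (⊤ : IntermediateField k K).FG) :
    IsLocallyUniformizable k K (⊤ : ValuationSubring K) := by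
  obtain ⟨A, hAO, hAfg, hAfr⟩ := exists_affineModel k K hfg ⊤ (fun c => ValuationSubring.mem_top _)
  haveI := hAfr
  refine ⟨A, hAO, hAfg, hAfr, ?_⟩
  have hbot : centreIdeal A ⊤ hAO = ⊥ := centreIdeal_top_eq_bot A hAO
  change IsRegularLocalRing (Localization.AtPrime (centreIdeal A ⊤ hAO))
  haveI : IsFractionRing A (Localization.AtPrime (centreIdeal A ⊤ hAO)) :=
    isFractionRing_localizationAtPrime_of_eq_bot _ hbot
  let e : K ≃ₐ[A] Localization.AtPrime (centreIdeal A ⊤ hAO) :=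
    IsLocalization.algEquiv (nonZeroDivisors A) K _
  exact IsRegularLocalRing.of_ringEquiv e.toRingEquiv

variable (O : ValuationSubring K) (hk : ∀ c : k, algebraMap k K c ∈ O)

/-- In transcendence degree `≤ 1` a non-trivial valuation ring containing `k` is a **prime
divisor**: `F + 1 = tr.deg._k(K) (= 1)`, by Abhyankar's inequality `E + F ≤ tr.deg.` and `E ≥ 1`.
PROVED. [folklore] -/
theorem residueTrdeg_add_one_eq_of_trdeg_le_one (hO : O ≠ ⊤) (hN : Algebra.trdeg k K ≤ 1) :
    residueTrdeg k O hk + 1 = Algebra.trdeg k K := by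
  have hNlt : Algebra.trdeg k K < ℵ₀ := hN.trans_lt Cardinal.one_lt_aleph0
  obtain ⟨N, hNn⟩ := Cardinal.lt_aleph0.mp hNlt
  obtain ⟨E, hE⟩ := Cardinal.lt_aleph0.mp (ratRank_lt_aleph0 O hk hNlt)
  obtain ⟨F, hF⟩ := Cardinal.lt_aleph0.mp (residueTrdeg_lt_aleph0 O hk hNlt)
  have h1 := one_le_ratRank_of_ne_top O hO
  have h2 := ratRank_add_residueTrdeg_le_trdeg O hk
  rw [hE] at h1
  rw [hE, hF, hNn] at h2
  rw [hNn] at hN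
  rw [hF, hNn]
  norm_cast at h1 h2 hN ⊢
  omega

include hk in
/-- **Temkin 2013, Thm. 1.3.2 (weak form) in transcendence degree `≤ 1`, uniformizability**: for
`K/k` finitely generated with `tr.deg._k(K) ≤ 1`, every valuation ring of `K` containing `k` is
locally uniformizable over `k` — the trivial one by `isLocallyUniformizable_top`, the others
being prime divisors (`isLocallyUniformizable_of_residueTrdeg`, `PrimeDivisors.lean`). PROVED.
[cite: Temkin2013, Thm. 1.3.2] -/
theorem isLocallyUniformizable_of_trdeg_le_one (hfg : (⊤ : IntermediateField k K).FG)
    (hN : Algebra.trdeg k K ≤ 1) : IsLocallyUniformizable k K O := by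
  by_cases hO : O = ⊤
  · subst hO
    exact isLocallyUniformizable_top hfg
  · exact isLocallyUniformizable_of_residueTrdeg O hk hfg hO
      (residueTrdeg_add_one_eq_of_trdeg_le_one O hk hO hN)

include hk in
/-- **Temkin 2013, Thm. 1.3.2 (weak form) in transcendence degree `≤ 1`**: the conclusion of the
named fact `Temkin2013` — a finite purely inseparable extension `L/K` and a valuation ring of `L`
over `K°` locally uniformizable over `k` — holds with `L = K`. PROVED special case of `Temkin2013`
(`LocalUniformization.lean`). [cite: Temkin2013, Thm. 1.3.2] -/
theorem temkin2013_of_trdeg_le_one (hfg : (⊤ : IntermediateField k K).FG)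
    (hN : Algebra.trdeg k K ≤ 1) :
    ∃ (L : Type u) (_ : Field L) (_ : Algebra K L) (_ : Algebra k L) (_ : IsScalarTower k K L),
      FiniteDimensional K L ∧ IsPurelyInseparable K L ∧
      ∃ O' : ValuationSubring L, O'.comap (algebraMap K L) = O ∧ IsLocallyUniformizable k L O' := by
  refine ⟨K, inferInstance, inferInstance, inferInstance, inferInstance, inferInstance,
    inferInstance, O, ?_, isLocallyUniformizable_of_trdeg_le_one O hk hfg hN⟩
  ext x
  simp

/-- The named fact `Temkin2013` **restricted to function fields of transcendence degree `≤ 1`**,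
as a closed statement. PROVED. [cite: Temkin2013, Thm. 1.3.2] -/
theorem temkin2013_curves :
    ∀ (k K : Type u) [Field k] [Field K] [Algebra k K], (⊤ : IntermediateField k K).FG →
      Algebra.trdeg k K ≤ 1 →
      ∀ O : ValuationSubring K, (∀ c : k, algebraMap k K c ∈ O) →
        ∃ (L : Type u) (_ : Field L) (_ : Algebra K L) (_ : Algebra k L) (_ : IsScalarTower k K L),
          FiniteDimensional K L ∧ IsPurelyInseparable K L ∧
          ∃ O' : ValuationSubring L, O'.comap (algebraMap K L) = O ∧
            IsLocallyUniformizable k L O' :=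
  fun _ _ _ _ _ hfg hN O hk' => temkin2013_of_trdeg_le_one O hk' hfg hN

end Literature.AlgebraicGeometry.Resolution
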